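import Literature.MathematicalPhysics.QuantumFieldTheory.AsymptoticFreedomScale
import Summits.QuantumFields.YangMills.Theorems.BalabanLadderUVSeamRecStubTransport

/-!
# The `G`-general two-loop asymptotic-freedom unit at `SU(2)` IS the spine's unit of record

Route `ForcedResponseSkewness` (cruxes stmt-QuantumFields-26871 `ResponseLocalisation`, -24275
`RunningCouplingCeiling`), LEAD seat `ym-line-frs-p1` g11.  The route owner's standing option (ii) (OWNER
ruling g11, R3) — restate the cruxes' unit pinning to «floor ∧ comparability with a NAMED `G`-general unit of
record» and move the fine half of the pinning (gap-class clustering) into the residual — was deferred "until a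
G-general named unit (needs `b₀(G)`) lands".  That unit is now the Literature definition
`LatticeRep.afUnit r β = afScale b₀(G,r) b₁(G,r) β` (`AsymptoticFreedomScale.lean`, on the adjoint-Casimir ratio
`λ(G,r)` of `RepKillingForm.lean`).  This file certifies that it extends the `SU(2)` spine consistently: for the
fundamental representation of `SU(2)` it is LITERALLY `UVSeamRec.Transport.uRec = exp ∘ (sizeLog · 1)` of
`FemtoTransferGap` / crux 20043, for every real `β` (junk values included).

Honest label: bookkeeping; nothing of E0′/E-sym/E-log, the residual 24873, NT (R2a leaf) or the Yang–Mills mass gap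
is proved here.
-/

noncomputable section

namespace Summit.QuantumFields.YangMills.Cruxes.ResponseLocalisation.AFUnit

open Literature.MathematicalPhysics.QuantumFieldTheory
open Literature.MathematicalPhysics.QuantumLattice (fundamentalLatticeRep)
open Summit.QuantumFields.YangMills.Theorems.FemtoTransferGap (b0 b1 sizeLog)

/-- **`afUnit (SU(2), fund) β = exp (sizeLog β 1)`** for every real `β`: the `G`-general two-loop unit
specialises to the spine's two-loop size label at `L = 1`. -/
theorem afUnit_fundamentalLatticeRep_two_eq_exp_sizeLog (β : ℝ) :
    (fundamentalLatticeRep 2).afUnit β = Real.exp (sizeLog β 1) := by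
  rw [afUnit_fundamentalLatticeRep_two, sizeLog, b0, b1, Nat.cast_one, Real.log_one, zero_sub]

/-- **`afUnit (SU(2), fund) = uRec`**, the unit of record of crux 20043 `UVSeamRec` / the spine's transport
stub (`Cruxes.UVSeamRec.Transport.uRec β = exp (sizeLog β 1)`). -/
theorem afUnit_fundamentalLatticeRep_two_eq_uRec :
    (fundamentalLatticeRep 2).afUnit = Summit.QuantumFields.YangMills.Cruxes.UVSeamRec.Transport.uRec := by
  funext β
  exact afUnit_fundamentalLatticeRep_two_eq_exp_sizeLog β

end Summit.QuantumFields.YangMills.Cruxes.ResponseLocalisation.AFUnit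

end
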